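import Mathlib
import HarnessLib
import Summits.Ventures.LatticeQCDFlow.Exactness.IMHColdStartAcceptance
import Summits.Ventures.LatticeQCDFlow.Scaling.AutoregressiveGaugeHeatBathColdExact

/-!
# LatticeQCDFlow / Scaling — the cold-started exact one-plaquette heat-bath sampler: its printed acceptance rate underestimates the
# equilibrium acceptance by exactly `(ā − A)·S_N/N`, `A = Z/(c^{#B} M^k)`, `S_N = (1 − (1 − A)^N)/A`

HONEST FRAMING: exact (Metropolis-corrected) sampling algorithms for lattice gauge theory;
figures of merit are autocorrelation/cost numbers at stated couplings and volumes; no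
continuum-physics claim.

Venture `LatticeQCDFlow` (cell pub-lqcd), topic `Scaling`, FANOUT row 30 (lean-1, GEN-32) — OUR WORK, the gauge
instance of `Exactness/IMHColdStartAcceptance` (this generation).  Setting: `L ≥ 2`; `w` continuous, `0 < m ≤ w ≤ M = w(1)`; `(B, t, rank)` a ranked
structure, `k = #Bᶜ`; target `π = (F/Z)·Haar^{⊗E}`, proposal `q = (F_B/Z_B)·Haar^{⊗E}`, exact sampler
`K = indepMH q (Z_B F_R/Z)`, cold configuration `U ≡ 1` = the mode of the importance weight, `A = Z/(c^{#B} M^k)` its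
acceptance mass (GEN-28 `heatBath_cold_acceptMass_eq`);
`A(U) = ∫ a(U, V) q(dV)` the acceptance mass at `U`, `ā = ∫ A dπ` the equilibrium acceptance, `S_N = Σ_{n<N}(1 − A)^n`.
The acceptance fraction is the first figure of merit every flow-MCMC study prints; from the cold start:

* **`heatBath_coldStart_acceptance`** — `E_cold[A(U_n)] = ā − (1 − A)^n·(ā − A)` EXACTLY (laws), rising monotonically
  in `n` (**`heatBath_coldStart_acceptance_mono`**) from `A` towards `ā` (GEN-31: `A ≤ ā ≤ ∫ A dq`, `∫ A dq ≥ 1/2`);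
* **`heatBath_coldStart_acceptRate_deficit`** — on path space, `N ≥ 1`:
  `(ā − A)/(1 + N·A) ≤ ā − (1/N)Σ_{n<N} E_cold[A(U_n)] ≤ (ā − A)·min(1, 1/(N·A))` — the measured acceptance of a
  cold-started run converges to the equilibrium acceptance like `1/(N·A)`, not geometrically;
* **`heatBath_coldStart_moveProb`** — atom-free Haar (`d ≥ 1`): the same number is the probability that step `n + 1`
  changes the configuration, `∫ K(U, {U}ᶜ) d(δ_cold K^n)(U) = ā − (1 − A)^n(ā − A)`.

NOT CLAIMED: the value of `ā` (GEN-31: `A ≤ ā ≤ ∫ A dq`); fluctuations of the measured acceptance.  No `def`, no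
`sorry`, nothing cited as a fact beyond the tree.
-/

noncomputable section

namespace Summit.Ventures.LatticeQCDFlow.Theory2.Autoregressive

open MeasureTheory ProbabilityTheory Function Finset
open scoped ENNReal
open Literature.MathematicalPhysics.QuantumFieldTheory Literature.MathematicalPhysics.QuantumLattice
open Summit.Ventures.LatticeQCDFlow.Exactness Summit.Ventures.LatticeQCDFlow.Scoring

variable {d L : ℕ} [NeZero L] {G : Type*} [Group G] [TopologicalSpace G] [IsTopologicalGroup G]
  [CompactSpace G] [SecondCountableTopology G] [MeasurableSpace G] [BorelSpace G]

/-- **`E_cold[A(U_n)] = ā − (1 − A)^n·(ā − A)` EXACTLY** for the cold-started exact one-plaquette heat-bath sampler (laws). [ours] -/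
theorem heatBath_coldStart_acceptance [MeasurableSingletonClass G] (hL : 2 ≤ L) {w : G → ℝ} (hw : Continuous w) {m M : ℝ} (hm0 : 0 < m)
    (hm : ∀ g, m ≤ w g) (hM : ∀ g, w g ≤ M) (hw1 : w 1 = M)
    (B : Finset (Plaquette d L)) (t : Plaquette d L → Edge d L)
    (ht : ∀ p ∈ B, t p ∈ ({(p.1, p.2.1.1), (p.1.shift p.2.1.1, p.2.1.2),
        (p.1.shift p.2.1.2, p.2.1.1), (p.1, p.2.1.2)} : Finset (Edge d L)))
    (rank : Plaquette d L → ℕ)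
    (hrank : ∀ p ∈ B, ∀ p' ∈ B, p ≠ p' → t p ∈ ({(p'.1, p'.2.1.1), (p'.1.shift p'.2.1.1, p'.2.1.2),
        (p'.1.shift p'.2.1.2, p'.2.1.1), (p'.1, p'.2.1.2)} : Finset (Edge d L)) → rank p < rank p')
    (π q : Measure (GaugeConfig d L G)) [IsProbabilityMeasure π] [IsProbabilityMeasure q]
    (hπ : π = (Measure.pi fun _ : Edge d L => haarProbability G).withDensity fun U =>
      ENNReal.ofReal ((∏ p : Plaquette d L, w (plaquetteHolonomy U p.1 p.2.1.1 p.2.1.2)) /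
        ∫ V, ∏ p : Plaquette d L, w (plaquetteHolonomy V p.1 p.2.1.1 p.2.1.2)
          ∂(Measure.pi fun _ : Edge d L => haarProbability G)))
    (hq : q = (Measure.pi fun _ : Edge d L => haarProbability G).withDensity fun U =>
      ENNReal.ofReal ((∏ p ∈ B, w (plaquetteHolonomy U p.1 p.2.1.1 p.2.1.2)) /
        ∫ V, ∏ p ∈ B, w (plaquetteHolonomy V p.1 p.2.1.1 p.2.1.2)
          ∂(Measure.pi fun _ : Edge d L => haarProbability G))) (n : ℕ) :
    ∫ U, (imhAcceptMass q (fun U =>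
        ((∫ V, ∏ p : Plaquette d L, w (plaquetteHolonomy V p.1 p.2.1.1 p.2.1.2)
            ∂(Measure.pi fun _ : Edge d L => haarProbability G)) /
          ((∫ V, ∏ p ∈ B, w (plaquetteHolonomy V p.1 p.2.1.1 p.2.1.2)
            ∂(Measure.pi fun _ : Edge d L => haarProbability G)) *
            ∏ p ∈ Finset.univ \ B, w (plaquetteHolonomy U p.1 p.2.1.1 p.2.1.2)))⁻¹) U).toReal ∂((fun ν : Measure (GaugeConfig d L G) => ν.bind (indepMH q (fun U =>
        ((∫ V, ∏ p : Plaquette d L, w (plaquetteHolonomy V p.1 p.2.1.1 p.2.1.2)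
            ∂(Measure.pi fun _ : Edge d L => haarProbability G)) /
          ((∫ V, ∏ p ∈ B, w (plaquetteHolonomy V p.1 p.2.1.1 p.2.1.2)
            ∂(Measure.pi fun _ : Edge d L => haarProbability G)) *
            ∏ p ∈ Finset.univ \ B, w (plaquetteHolonomy U p.1 p.2.1.1 p.2.1.2)))⁻¹)))^[n]
        (Measure.dirac (fun _ : Edge d L => (1 : G)))) =
      ∫ U, (imhAcceptMass q (fun U =>
        ((∫ V, ∏ p : Plaquette d L, w (plaquetteHolonomy V p.1 p.2.1.1 p.2.1.2)
            ∂(Measure.pi fun _ : Edge d L => haarProbability G)) /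
          ((∫ V, ∏ p ∈ B, w (plaquetteHolonomy V p.1 p.2.1.1 p.2.1.2)
            ∂(Measure.pi fun _ : Edge d L => haarProbability G)) *
            ∏ p ∈ Finset.univ \ B, w (plaquetteHolonomy U p.1 p.2.1.1 p.2.1.2)))⁻¹) U).toReal ∂π -
        (1 - ((∫ V, ∏ p : Plaquette d L, w (plaquetteHolonomy V p.1 p.2.1.1 p.2.1.2)
            ∂(Measure.pi fun _ : Edge d L => haarProbability G)) /
        ((∫ g, w g ∂(haarProbability G)) ^ B.card * M ^ (Finset.univ \ B).card))) ^ n *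
          (∫ U, (imhAcceptMass q (fun U =>
        ((∫ V, ∏ p : Plaquette d L, w (plaquetteHolonomy V p.1 p.2.1.1 p.2.1.2)
            ∂(Measure.pi fun _ : Edge d L => haarProbability G)) /
          ((∫ V, ∏ p ∈ B, w (plaquetteHolonomy V p.1 p.2.1.1 p.2.1.2)
            ∂(Measure.pi fun _ : Edge d L => haarProbability G)) *
            ∏ p ∈ Finset.univ \ B, w (plaquetteHolonomy U p.1 p.2.1.1 p.2.1.2)))⁻¹) U).toReal ∂π -
            ((∫ V, ∏ p : Plaquette d L, w (plaquetteHolonomy V p.1 p.2.1.1 p.2.1.2)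
            ∂(Measure.pi fun _ : Edge d L => haarProbability G)) /
        ((∫ g, w g ∂(haarProbability G)) ^ B.card * M ^ (Finset.univ \ B).card))) := by
  obtain ⟨hA, hρq, hmax, hρm, hρpos⟩ := heatBath_cold_acceptMass_eq hL hw hm0 hm hM hw1 B t ht rank hrank π q hπ hq
  set cold : GaugeConfig d L G := fun _ => (1 : G) with hcold
  set ρ : GaugeConfig d L G → ℝ := fun U => (∫ V, ∏ p : Plaquette d L, w (plaquetteHolonomy V p.1 p.2.1.1 p.2.1.2)
            ∂(Measure.pi fun _ : Edge d L => haarProbability G)) /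
          ((∫ V, ∏ p ∈ B, w (plaquetteHolonomy V p.1 p.2.1.1 p.2.1.2)
            ∂(Measure.pi fun _ : Edge d L => haarProbability G)) *
            ∏ p ∈ Finset.univ \ B, w (plaquetteHolonomy U p.1 p.2.1.1 p.2.1.2)) with hρ
  have hwm : Measurable fun U => (ρ U)⁻¹ := hρm.inv
  have hw0' : ∀ U, 0 < (ρ U)⁻¹ := fun U => inv_pos.2 (hρpos U)
  have hπ' : (q.withDensity fun U => ENNReal.ofReal (ρ U)⁻¹) = π := withDensity_inv_density hρm hρpos hρq
  haveI : IsProbabilityMeasure (q.withDensity fun U => ENNReal.ofReal (ρ U)⁻¹) := by rw [hπ']; infer_instance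
  have hone : ∫⁻ y, ENNReal.ofReal (ρ y)⁻¹ ∂q = ENNReal.ofReal 1 := by
    have h : π Set.univ = 1 := measure_univ
    rw [← hπ', withDensity_apply _ MeasurableSet.univ, Measure.restrict_univ] at h
    rw [h, ENNReal.ofReal_one]
  have hA' := imhAcceptMass_toReal_eq_of_forall_le (q := q) hw0' cold hmax zero_le_one hone
  have hrate : ((ρ cold)⁻¹)⁻¹ = (∫ V, ∏ p : Plaquette d L, w (plaquetteHolonomy V p.1 p.2.1.1 p.2.1.2)
            ∂(Measure.pi fun _ : Edge d L => haarProbability G)) /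
        ((∫ g, w g ∂(haarProbability G)) ^ B.card * M ^ (Finset.univ \ B).card) := by
    rw [← hA, hA', one_div]
  have h := integral_acceptMass_coldStart_mode (q := q) hwm hw0' hmax n (x₀ := cold)
  rw [hπ', hrate] at h
  exact h

/-- **The expected acceptance rises monotonically along the cold-started run.** [ours] -/
theorem heatBath_coldStart_acceptance_mono [MeasurableSingletonClass G] (hL : 2 ≤ L) {w : G → ℝ} (hw : Continuous w) {m M : ℝ} (hm0 : 0 < m)
    (hm : ∀ g, m ≤ w g) (hM : ∀ g, w g ≤ M) (hw1 : w 1 = M)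
    (B : Finset (Plaquette d L)) (t : Plaquette d L → Edge d L)
    (ht : ∀ p ∈ B, t p ∈ ({(p.1, p.2.1.1), (p.1.shift p.2.1.1, p.2.1.2),
        (p.1.shift p.2.1.2, p.2.1.1), (p.1, p.2.1.2)} : Finset (Edge d L)))
    (rank : Plaquette d L → ℕ)
    (hrank : ∀ p ∈ B, ∀ p' ∈ B, p ≠ p' → t p ∈ ({(p'.1, p'.2.1.1), (p'.1.shift p'.2.1.1, p'.2.1.2),
        (p'.1.shift p'.2.1.2, p'.2.1.1), (p'.1, p'.2.1.2)} : Finset (Edge d L)) → rank p < rank p')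
    (π q : Measure (GaugeConfig d L G)) [IsProbabilityMeasure π] [IsProbabilityMeasure q]
    (hπ : π = (Measure.pi fun _ : Edge d L => haarProbability G).withDensity fun U =>
      ENNReal.ofReal ((∏ p : Plaquette d L, w (plaquetteHolonomy U p.1 p.2.1.1 p.2.1.2)) /
        ∫ V, ∏ p : Plaquette d L, w (plaquetteHolonomy V p.1 p.2.1.1 p.2.1.2)
          ∂(Measure.pi fun _ : Edge d L => haarProbability G)))
    (hq : q = (Measure.pi fun _ : Edge d L => haarProbability G).withDensity fun U =>
      ENNReal.ofReal ((∏ p ∈ B, w (plaquetteHolonomy U p.1 p.2.1.1 p.2.1.2)) /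
        ∫ V, ∏ p ∈ B, w (plaquetteHolonomy V p.1 p.2.1.1 p.2.1.2)
          ∂(Measure.pi fun _ : Edge d L => haarProbability G))) :
    Monotone fun n : ℕ => ∫ U, (imhAcceptMass q (fun U =>
        ((∫ V, ∏ p : Plaquette d L, w (plaquetteHolonomy V p.1 p.2.1.1 p.2.1.2)
            ∂(Measure.pi fun _ : Edge d L => haarProbability G)) /
          ((∫ V, ∏ p ∈ B, w (plaquetteHolonomy V p.1 p.2.1.1 p.2.1.2)
            ∂(Measure.pi fun _ : Edge d L => haarProbability G)) *
            ∏ p ∈ Finset.univ \ B, w (plaquetteHolonomy U p.1 p.2.1.1 p.2.1.2)))⁻¹) U).toReal ∂((fun ν : Measure (GaugeConfig d L G) => ν.bind (indepMH q (fun U =>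
        ((∫ V, ∏ p : Plaquette d L, w (plaquetteHolonomy V p.1 p.2.1.1 p.2.1.2)
            ∂(Measure.pi fun _ : Edge d L => haarProbability G)) /
          ((∫ V, ∏ p ∈ B, w (plaquetteHolonomy V p.1 p.2.1.1 p.2.1.2)
            ∂(Measure.pi fun _ : Edge d L => haarProbability G)) *
            ∏ p ∈ Finset.univ \ B, w (plaquetteHolonomy U p.1 p.2.1.1 p.2.1.2)))⁻¹)))^[n]
        (Measure.dirac (fun _ : Edge d L => (1 : G)))) := by
  obtain ⟨hA, hρq, hmax, hρm, hρpos⟩ := heatBath_cold_acceptMass_eq hL hw hm0 hm hM hw1 B t ht rank hrank π q hπ hq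
  set cold : GaugeConfig d L G := fun _ => (1 : G) with hcold
  set ρ : GaugeConfig d L G → ℝ := fun U => (∫ V, ∏ p : Plaquette d L, w (plaquetteHolonomy V p.1 p.2.1.1 p.2.1.2)
            ∂(Measure.pi fun _ : Edge d L => haarProbability G)) /
          ((∫ V, ∏ p ∈ B, w (plaquetteHolonomy V p.1 p.2.1.1 p.2.1.2)
            ∂(Measure.pi fun _ : Edge d L => haarProbability G)) *
            ∏ p ∈ Finset.univ \ B, w (plaquetteHolonomy U p.1 p.2.1.1 p.2.1.2)) with hρ
  have hwm : Measurable fun U => (ρ U)⁻¹ := hρm.inv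
  have hw0' : ∀ U, 0 < (ρ U)⁻¹ := fun U => inv_pos.2 (hρpos U)
  have hπ' : (q.withDensity fun U => ENNReal.ofReal (ρ U)⁻¹) = π := withDensity_inv_density hρm hρpos hρq
  haveI : IsProbabilityMeasure (q.withDensity fun U => ENNReal.ofReal (ρ U)⁻¹) := by rw [hπ']; infer_instance
  have hone : ∫⁻ y, ENNReal.ofReal (ρ y)⁻¹ ∂q = ENNReal.ofReal 1 := by
    have h : π Set.univ = 1 := measure_univ
    rw [← hπ', withDensity_apply _ MeasurableSet.univ, Measure.restrict_univ] at h
    rw [h, ENNReal.ofReal_one]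
  have hA' := imhAcceptMass_toReal_eq_of_forall_le (q := q) hw0' cold hmax zero_le_one hone
  have hrate : ((ρ cold)⁻¹)⁻¹ = (∫ V, ∏ p : Plaquette d L, w (plaquetteHolonomy V p.1 p.2.1.1 p.2.1.2)
            ∂(Measure.pi fun _ : Edge d L => haarProbability G)) /
        ((∫ g, w g ∂(haarProbability G)) ^ B.card * M ^ (Finset.univ \ B).card) := by
    rw [← hA, hA', one_div]
  exact integral_acceptMass_coldStart_mono (q := q) hwm hw0' hmax (x₀ := cold)

/-- **THE PRINTED ACCEPTANCE OF A COLD-STARTED RUN, TWO-SIDED** (path space, `N ≥ 1`):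
`(ā − A)/(1 + N·A) ≤ ā − (1/N)Σ_{n<N} E_cold[A(U_n)] ≤ (ā − A)·min(1, 1/(N·A))`. [ours] -/
theorem heatBath_coldStart_acceptRate_deficit [MeasurableSingletonClass G] (hL : 2 ≤ L) {w : G → ℝ} (hw : Continuous w) {m M : ℝ} (hm0 : 0 < m)
    (hm : ∀ g, m ≤ w g) (hM : ∀ g, w g ≤ M) (hw1 : w 1 = M)
    (B : Finset (Plaquette d L)) (t : Plaquette d L → Edge d L)
    (ht : ∀ p ∈ B, t p ∈ ({(p.1, p.2.1.1), (p.1.shift p.2.1.1, p.2.1.2),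
        (p.1.shift p.2.1.2, p.2.1.1), (p.1, p.2.1.2)} : Finset (Edge d L)))
    (rank : Plaquette d L → ℕ)
    (hrank : ∀ p ∈ B, ∀ p' ∈ B, p ≠ p' → t p ∈ ({(p'.1, p'.2.1.1), (p'.1.shift p'.2.1.1, p'.2.1.2),
        (p'.1.shift p'.2.1.2, p'.2.1.1), (p'.1, p'.2.1.2)} : Finset (Edge d L)) → rank p < rank p')
    (π q : Measure (GaugeConfig d L G)) [IsProbabilityMeasure π] [IsProbabilityMeasure q]
    (hπ : π = (Measure.pi fun _ : Edge d L => haarProbability G).withDensity fun U =>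
      ENNReal.ofReal ((∏ p : Plaquette d L, w (plaquetteHolonomy U p.1 p.2.1.1 p.2.1.2)) /
        ∫ V, ∏ p : Plaquette d L, w (plaquetteHolonomy V p.1 p.2.1.1 p.2.1.2)
          ∂(Measure.pi fun _ : Edge d L => haarProbability G)))
    (hq : q = (Measure.pi fun _ : Edge d L => haarProbability G).withDensity fun U =>
      ENNReal.ofReal ((∏ p ∈ B, w (plaquetteHolonomy U p.1 p.2.1.1 p.2.1.2)) /
        ∫ V, ∏ p ∈ B, w (plaquetteHolonomy V p.1 p.2.1.1 p.2.1.2)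
          ∂(Measure.pi fun _ : Edge d L => haarProbability G)))
    [Fact (Measurable (fun U =>
        ((∫ V, ∏ p : Plaquette d L, w (plaquetteHolonomy V p.1 p.2.1.1 p.2.1.2)
            ∂(Measure.pi fun _ : Edge d L => haarProbability G)) /
          ((∫ V, ∏ p ∈ B, w (plaquetteHolonomy V p.1 p.2.1.1 p.2.1.2)
            ∂(Measure.pi fun _ : Edge d L => haarProbability G)) *
            ∏ p ∈ Finset.univ \ B, w (plaquetteHolonomy U p.1 p.2.1.1 p.2.1.2)))⁻¹))] {N : ℕ} (hN : N ≠ 0) :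
    (∫ U, (imhAcceptMass q (fun U =>
        ((∫ V, ∏ p : Plaquette d L, w (plaquetteHolonomy V p.1 p.2.1.1 p.2.1.2)
            ∂(Measure.pi fun _ : Edge d L => haarProbability G)) /
          ((∫ V, ∏ p ∈ B, w (plaquetteHolonomy V p.1 p.2.1.1 p.2.1.2)
            ∂(Measure.pi fun _ : Edge d L => haarProbability G)) *
            ∏ p ∈ Finset.univ \ B, w (plaquetteHolonomy U p.1 p.2.1.1 p.2.1.2)))⁻¹) U).toReal ∂π - ((∫ V, ∏ p : Plaquette d L, w (plaquetteHolonomy V p.1 p.2.1.1 p.2.1.2)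
            ∂(Measure.pi fun _ : Edge d L => haarProbability G)) /
        ((∫ g, w g ∂(haarProbability G)) ^ B.card * M ^ (Finset.univ \ B).card))) *
        (1 / (1 + N * ((∫ V, ∏ p : Plaquette d L, w (plaquetteHolonomy V p.1 p.2.1.1 p.2.1.2)
            ∂(Measure.pi fun _ : Edge d L => haarProbability G)) /
        ((∫ g, w g ∂(haarProbability G)) ^ B.card * M ^ (Finset.univ \ B).card)))) ≤
      ∫ U, (imhAcceptMass q (fun U =>
        ((∫ V, ∏ p : Plaquette d L, w (plaquetteHolonomy V p.1 p.2.1.1 p.2.1.2)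
            ∂(Measure.pi fun _ : Edge d L => haarProbability G)) /
          ((∫ V, ∏ p ∈ B, w (plaquetteHolonomy V p.1 p.2.1.1 p.2.1.2)
            ∂(Measure.pi fun _ : Edge d L => haarProbability G)) *
            ∏ p ∈ Finset.univ \ B, w (plaquetteHolonomy U p.1 p.2.1.1 p.2.1.2)))⁻¹) U).toReal ∂π -
        (∑ n ∈ Finset.range N, ∫ x, (imhAcceptMass q (fun U =>
        ((∫ V, ∏ p : Plaquette d L, w (plaquetteHolonomy V p.1 p.2.1.1 p.2.1.2)
            ∂(Measure.pi fun _ : Edge d L => haarProbability G)) /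
          ((∫ V, ∏ p ∈ B, w (plaquetteHolonomy V p.1 p.2.1.1 p.2.1.2)
            ∂(Measure.pi fun _ : Edge d L => haarProbability G)) *
            ∏ p ∈ Finset.univ \ B, w (plaquetteHolonomy U p.1 p.2.1.1 p.2.1.2)))⁻¹) (x n)).toReal ∂(Kernel.trajMeasure (X := fun _ : ℕ => GaugeConfig d L G) (Measure.dirac (fun _ : Edge d L => (1 : G)))
        (fun n : ℕ => (indepMH q (fun U =>
        ((∫ V, ∏ p : Plaquette d L, w (plaquetteHolonomy V p.1 p.2.1.1 p.2.1.2)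
            ∂(Measure.pi fun _ : Edge d L => haarProbability G)) /
          ((∫ V, ∏ p ∈ B, w (plaquetteHolonomy V p.1 p.2.1.1 p.2.1.2)
            ∂(Measure.pi fun _ : Edge d L => haarProbability G)) *
            ∏ p ∈ Finset.univ \ B, w (plaquetteHolonomy U p.1 p.2.1.1 p.2.1.2)))⁻¹)).comap
          (fun h : (i : ↥(Finset.Iic n)) → GaugeConfig d L G => h ⟨n, Finset.mem_Iic.2 le_rfl⟩)
          (measurable_pi_apply _)))) / N ∧
    ∫ U, (imhAcceptMass q (fun U =>
        ((∫ V, ∏ p : Plaquette d L, w (plaquetteHolonomy V p.1 p.2.1.1 p.2.1.2)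
            ∂(Measure.pi fun _ : Edge d L => haarProbability G)) /
          ((∫ V, ∏ p ∈ B, w (plaquetteHolonomy V p.1 p.2.1.1 p.2.1.2)
            ∂(Measure.pi fun _ : Edge d L => haarProbability G)) *
            ∏ p ∈ Finset.univ \ B, w (plaquetteHolonomy U p.1 p.2.1.1 p.2.1.2)))⁻¹) U).toReal ∂π -
        (∑ n ∈ Finset.range N, ∫ x, (imhAcceptMass q (fun U =>
        ((∫ V, ∏ p : Plaquette d L, w (plaquetteHolonomy V p.1 p.2.1.1 p.2.1.2)
            ∂(Measure.pi fun _ : Edge d L => haarProbability G)) /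
          ((∫ V, ∏ p ∈ B, w (plaquetteHolonomy V p.1 p.2.1.1 p.2.1.2)
            ∂(Measure.pi fun _ : Edge d L => haarProbability G)) *
            ∏ p ∈ Finset.univ \ B, w (plaquetteHolonomy U p.1 p.2.1.1 p.2.1.2)))⁻¹) (x n)).toReal ∂(Kernel.trajMeasure (X := fun _ : ℕ => GaugeConfig d L G) (Measure.dirac (fun _ : Edge d L => (1 : G)))
        (fun n : ℕ => (indepMH q (fun U =>
        ((∫ V, ∏ p : Plaquette d L, w (plaquetteHolonomy V p.1 p.2.1.1 p.2.1.2)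
            ∂(Measure.pi fun _ : Edge d L => haarProbability G)) /
          ((∫ V, ∏ p ∈ B, w (plaquetteHolonomy V p.1 p.2.1.1 p.2.1.2)
            ∂(Measure.pi fun _ : Edge d L => haarProbability G)) *
            ∏ p ∈ Finset.univ \ B, w (plaquetteHolonomy U p.1 p.2.1.1 p.2.1.2)))⁻¹)).comap
          (fun h : (i : ↥(Finset.Iic n)) → GaugeConfig d L G => h ⟨n, Finset.mem_Iic.2 le_rfl⟩)
          (measurable_pi_apply _)))) / N ≤
      (∫ U, (imhAcceptMass q (fun U =>
        ((∫ V, ∏ p : Plaquette d L, w (plaquetteHolonomy V p.1 p.2.1.1 p.2.1.2)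
            ∂(Measure.pi fun _ : Edge d L => haarProbability G)) /
          ((∫ V, ∏ p ∈ B, w (plaquetteHolonomy V p.1 p.2.1.1 p.2.1.2)
            ∂(Measure.pi fun _ : Edge d L => haarProbability G)) *
            ∏ p ∈ Finset.univ \ B, w (plaquetteHolonomy U p.1 p.2.1.1 p.2.1.2)))⁻¹) U).toReal ∂π - ((∫ V, ∏ p : Plaquette d L, w (plaquetteHolonomy V p.1 p.2.1.1 p.2.1.2)
            ∂(Measure.pi fun _ : Edge d L => haarProbability G)) /
        ((∫ g, w g ∂(haarProbability G)) ^ B.card * M ^ (Finset.univ \ B).card))) *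
        min 1 (((∫ V, ∏ p : Plaquette d L, w (plaquetteHolonomy V p.1 p.2.1.1 p.2.1.2)
            ∂(Measure.pi fun _ : Edge d L => haarProbability G)) /
        ((∫ g, w g ∂(haarProbability G)) ^ B.card * M ^ (Finset.univ \ B).card))⁻¹ / N) := by
  obtain ⟨hA, hρq, hmax, hρm, hρpos⟩ := heatBath_cold_acceptMass_eq hL hw hm0 hm hM hw1 B t ht rank hrank π q hπ hq
  set cold : GaugeConfig d L G := fun _ => (1 : G) with hcold
  set ρ : GaugeConfig d L G → ℝ := fun U => (∫ V, ∏ p : Plaquette d L, w (plaquetteHolonomy V p.1 p.2.1.1 p.2.1.2)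
            ∂(Measure.pi fun _ : Edge d L => haarProbability G)) /
          ((∫ V, ∏ p ∈ B, w (plaquetteHolonomy V p.1 p.2.1.1 p.2.1.2)
            ∂(Measure.pi fun _ : Edge d L => haarProbability G)) *
            ∏ p ∈ Finset.univ \ B, w (plaquetteHolonomy U p.1 p.2.1.1 p.2.1.2)) with hρ
  have hwm : Measurable fun U => (ρ U)⁻¹ := hρm.inv
  have hw0' : ∀ U, 0 < (ρ U)⁻¹ := fun U => inv_pos.2 (hρpos U)
  have hπ' : (q.withDensity fun U => ENNReal.ofReal (ρ U)⁻¹) = π := withDensity_inv_density hρm hρpos hρq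
  haveI : IsProbabilityMeasure (q.withDensity fun U => ENNReal.ofReal (ρ U)⁻¹) := by rw [hπ']; infer_instance
  have hone : ∫⁻ y, ENNReal.ofReal (ρ y)⁻¹ ∂q = ENNReal.ofReal 1 := by
    have h : π Set.univ = 1 := measure_univ
    rw [← hπ', withDensity_apply _ MeasurableSet.univ, Measure.restrict_univ] at h
    rw [h, ENNReal.ofReal_one]
  have hA' := imhAcceptMass_toReal_eq_of_forall_le (q := q) hw0' cold hmax zero_le_one hone
  have hrate : ((ρ cold)⁻¹)⁻¹ = (∫ V, ∏ p : Plaquette d L, w (plaquetteHolonomy V p.1 p.2.1.1 p.2.1.2)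
            ∂(Measure.pi fun _ : Edge d L => haarProbability G)) /
        ((∫ g, w g ∂(haarProbability G)) ^ B.card * M ^ (Finset.univ \ B).card) := by
    rw [← hA, hA', one_div]
  have hrate' : (ρ cold)⁻¹ = (((∫ V, ∏ p : Plaquette d L, w (plaquetteHolonomy V p.1 p.2.1.1 p.2.1.2)
            ∂(Measure.pi fun _ : Edge d L => haarProbability G)) /
        ((∫ g, w g ∂(haarProbability G)) ^ B.card * M ^ (Finset.univ \ B).card)))⁻¹ := by
    rw [← hrate, inv_inv]
  have h := imh_chain_acceptRate_deficit_two_sided (q := q) hw0' hmax hN (x₀ := cold)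
  rw [hπ', hrate, hrate'] at h
  exact h

/-- **The move probability** (atom-free Haar, `d ≥ 1`): `∫ K(U, {U}ᶜ) d(δ_cold K^n)(U) = ā − (1 − A)^n·(ā − A)`. [ours] -/
theorem heatBath_coldStart_moveProb [MeasurableSingletonClass G] (hd : 1 ≤ d) [NullSingletonClass (haarProbability G)] (hL : 2 ≤ L) {w : G → ℝ} (hw : Continuous w) {m M : ℝ} (hm0 : 0 < m)
    (hm : ∀ g, m ≤ w g) (hM : ∀ g, w g ≤ M) (hw1 : w 1 = M)
    (B : Finset (Plaquette d L)) (t : Plaquette d L → Edge d L)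
    (ht : ∀ p ∈ B, t p ∈ ({(p.1, p.2.1.1), (p.1.shift p.2.1.1, p.2.1.2),
        (p.1.shift p.2.1.2, p.2.1.1), (p.1, p.2.1.2)} : Finset (Edge d L)))
    (rank : Plaquette d L → ℕ)
    (hrank : ∀ p ∈ B, ∀ p' ∈ B, p ≠ p' → t p ∈ ({(p'.1, p'.2.1.1), (p'.1.shift p'.2.1.1, p'.2.1.2),
        (p'.1.shift p'.2.1.2, p'.2.1.1), (p'.1, p'.2.1.2)} : Finset (Edge d L)) → rank p < rank p')
    (π q : Measure (GaugeConfig d L G)) [IsProbabilityMeasure π] [IsProbabilityMeasure q]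
    (hπ : π = (Measure.pi fun _ : Edge d L => haarProbability G).withDensity fun U =>
      ENNReal.ofReal ((∏ p : Plaquette d L, w (plaquetteHolonomy U p.1 p.2.1.1 p.2.1.2)) /
        ∫ V, ∏ p : Plaquette d L, w (plaquetteHolonomy V p.1 p.2.1.1 p.2.1.2)
          ∂(Measure.pi fun _ : Edge d L => haarProbability G)))
    (hq : q = (Measure.pi fun _ : Edge d L => haarProbability G).withDensity fun U =>
      ENNReal.ofReal ((∏ p ∈ B, w (plaquetteHolonomy U p.1 p.2.1.1 p.2.1.2)) /
        ∫ V, ∏ p ∈ B, w (plaquetteHolonomy V p.1 p.2.1.1 p.2.1.2)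
          ∂(Measure.pi fun _ : Edge d L => haarProbability G))) (n : ℕ) :
    ∫ U, (indepMH q (fun U =>
        ((∫ V, ∏ p : Plaquette d L, w (plaquetteHolonomy V p.1 p.2.1.1 p.2.1.2)
            ∂(Measure.pi fun _ : Edge d L => haarProbability G)) /
          ((∫ V, ∏ p ∈ B, w (plaquetteHolonomy V p.1 p.2.1.1 p.2.1.2)
            ∂(Measure.pi fun _ : Edge d L => haarProbability G)) *
            ∏ p ∈ Finset.univ \ B, w (plaquetteHolonomy U p.1 p.2.1.1 p.2.1.2)))⁻¹) U {U}ᶜ).toReal ∂((fun ν : Measure (GaugeConfig d L G) => ν.bind (indepMH q (fun U =>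
        ((∫ V, ∏ p : Plaquette d L, w (plaquetteHolonomy V p.1 p.2.1.1 p.2.1.2)
            ∂(Measure.pi fun _ : Edge d L => haarProbability G)) /
          ((∫ V, ∏ p ∈ B, w (plaquetteHolonomy V p.1 p.2.1.1 p.2.1.2)
            ∂(Measure.pi fun _ : Edge d L => haarProbability G)) *
            ∏ p ∈ Finset.univ \ B, w (plaquetteHolonomy U p.1 p.2.1.1 p.2.1.2)))⁻¹)))^[n]
        (Measure.dirac (fun _ : Edge d L => (1 : G)))) =
      ∫ U, (imhAcceptMass q (fun U =>
        ((∫ V, ∏ p : Plaquette d L, w (plaquetteHolonomy V p.1 p.2.1.1 p.2.1.2)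
            ∂(Measure.pi fun _ : Edge d L => haarProbability G)) /
          ((∫ V, ∏ p ∈ B, w (plaquetteHolonomy V p.1 p.2.1.1 p.2.1.2)
            ∂(Measure.pi fun _ : Edge d L => haarProbability G)) *
            ∏ p ∈ Finset.univ \ B, w (plaquetteHolonomy U p.1 p.2.1.1 p.2.1.2)))⁻¹) U).toReal ∂π -
        (1 - ((∫ V, ∏ p : Plaquette d L, w (plaquetteHolonomy V p.1 p.2.1.1 p.2.1.2)
            ∂(Measure.pi fun _ : Edge d L => haarProbability G)) /
        ((∫ g, w g ∂(haarProbability G)) ^ B.card * M ^ (Finset.univ \ B).card))) ^ n *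
          (∫ U, (imhAcceptMass q (fun U =>
        ((∫ V, ∏ p : Plaquette d L, w (plaquetteHolonomy V p.1 p.2.1.1 p.2.1.2)
            ∂(Measure.pi fun _ : Edge d L => haarProbability G)) /
          ((∫ V, ∏ p ∈ B, w (plaquetteHolonomy V p.1 p.2.1.1 p.2.1.2)
            ∂(Measure.pi fun _ : Edge d L => haarProbability G)) *
            ∏ p ∈ Finset.univ \ B, w (plaquetteHolonomy U p.1 p.2.1.1 p.2.1.2)))⁻¹) U).toReal ∂π -
            ((∫ V, ∏ p : Plaquette d L, w (plaquetteHolonomy V p.1 p.2.1.1 p.2.1.2)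
            ∂(Measure.pi fun _ : Edge d L => haarProbability G)) /
        ((∫ g, w g ∂(haarProbability G)) ^ B.card * M ^ (Finset.univ \ B).card))) := by
  obtain ⟨hA, hρq, hmax, hρm, hρpos⟩ := heatBath_cold_acceptMass_eq hL hw hm0 hm hM hw1 B t ht rank hrank π q hπ hq
  set cold : GaugeConfig d L G := fun _ => (1 : G) with hcold
  set ρ : GaugeConfig d L G → ℝ := fun U => (∫ V, ∏ p : Plaquette d L, w (plaquetteHolonomy V p.1 p.2.1.1 p.2.1.2)
            ∂(Measure.pi fun _ : Edge d L => haarProbability G)) /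
          ((∫ V, ∏ p ∈ B, w (plaquetteHolonomy V p.1 p.2.1.1 p.2.1.2)
            ∂(Measure.pi fun _ : Edge d L => haarProbability G)) *
            ∏ p ∈ Finset.univ \ B, w (plaquetteHolonomy U p.1 p.2.1.1 p.2.1.2)) with hρ
  have hwm : Measurable fun U => (ρ U)⁻¹ := hρm.inv
  have hw0' : ∀ U, 0 < (ρ U)⁻¹ := fun U => inv_pos.2 (hρpos U)
  have hπ' : (q.withDensity fun U => ENNReal.ofReal (ρ U)⁻¹) = π := withDensity_inv_density hρm hρpos hρq
  haveI : IsProbabilityMeasure (q.withDensity fun U => ENNReal.ofReal (ρ U)⁻¹) := by rw [hπ']; infer_instance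
  have hone : ∫⁻ y, ENNReal.ofReal (ρ y)⁻¹ ∂q = ENNReal.ofReal 1 := by
    have h : π Set.univ = 1 := measure_univ
    rw [← hπ', withDensity_apply _ MeasurableSet.univ, Measure.restrict_univ] at h
    rw [h, ENNReal.ofReal_one]
  have hA' := imhAcceptMass_toReal_eq_of_forall_le (q := q) hw0' cold hmax zero_le_one hone
  have hrate : ((ρ cold)⁻¹)⁻¹ = (∫ V, ∏ p : Plaquette d L, w (plaquetteHolonomy V p.1 p.2.1.1 p.2.1.2)
            ∂(Measure.pi fun _ : Edge d L => haarProbability G)) /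
        ((∫ g, w g ∂(haarProbability G)) ^ B.card * M ^ (Finset.univ \ B).card) := by
    rw [← hA, hA', one_div]
  haveI : Nonempty (Edge d L) := ⟨(fun _ => 0, ⟨0, hd⟩)⟩
  have hq0 : ∀ U : GaugeConfig d L G, q {U} = 0 := fun U => by
    rw [hq]
    exact withDensity_absolutelyContinuous _ _ (measure_singleton U)
  have h := integral_moveProb_coldStart_mode (q := q) hwm hw0' hmax hq0 n (x₀ := cold)
  rw [hπ', hrate] at h
  exact h

end Summit.Ventures.LatticeQCDFlow.Theory2.Autoregressive

end
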